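import Summits.AtomisticToContinuum.BoseEinsteinCondensation.Theses.BECInfDivCoherence
import Summits.AtomisticToContinuum.BoseEinsteinCondensation.Theorems.BECInfDivCoherenceGridInfDivCoherenceGridAverageFromMoments
import Summits.AtomisticToContinuum.BoseEinsteinCondensation.Theorems.BECInfDivCoherenceLevyMassCondensationEnergy
import HarnessLib

/-!
# Route `BECInfDivCoherence`, crux `GridInfDivCoherence` (stmt-AtomisticToContinuum-9114): the route closes
# equally with the crux WEAKENED to a `λ`-weighted negative-Lévy-mass bound (`NegLevySecondMoment`)

Support file (`--supports stmt-AtomisticToContinuum-9114`; lead c2). `periodicBEC_of_negLevySecondMoment`: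
the statement of the glue item `LevyMassCondensation` (stmt-9117) with its first hypothesis
`GridInfDivCoherence` ("all discrete Lévy weights `ν̃_q ≥ −ε`, `∀ ε ∃ δ`") replaced by the strictly weaker
"`G > 0` at the grid nodes and `Σ_{q≠0} ν̃_q⁻ λ_q ≤ B (L/m)²` for some constant `B = B(v, η)`, `∃ δ`"
(`λ_q = Σ_a (1 − cos(2πq_a/m))`, i.e. the NEGATIVE part of the grid Lévy measure has an `N`-uniform discrete
second moment) — and `ScatteringLengthFinite` dropped, as in the landed glue. Proof: quantifier bookkeeping of
the landed glue verbatim (uniform energy ceiling `periodicGroundStateEnergy_le_uniform`, pigeonhole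
`exists_particle_kinetic_le`, `GridAverageCondensate`), the analytic middle being the single-state lemma
`gridAverage_exp_lower_bound` with `s = 1`. This is the evidence for the lead's restatement proposal: the
crux as filed stakes the route on a pointwise sign that the glue never uses.
References: Berg–Christensen–Ressel (1984) Ch. 3–4; Lieb–Seiringer–Solovej–Yngvason (2005) Thm 2.2.
-/

noncomputable section

namespace Summit.AtomisticToContinuum.BoseEinsteinCondensation.Theorems

open MeasureTheory Filter InfDivGlue
open Literature.MathematicalPhysics.QuantumManyBody.BoseGas
open scoped ENNReal ComplexConjugate

/-- **The route's glue with the crux weakened to a `λ`-weighted negative-mass bound** (lead c2's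
restatement proposal for `GridInfDivCoherence`, stmt-AtomisticToContinuum-9114). If, for every repulsive
finite-range `v`, there are a UV scale `η > 0`, a constant `B` and `ρ₀ > 0` such that for `0 < ρ < ρ₀`,
eventually in `N`, some `δ > 0`: every `δ`-near-minimiser has translation coherence `G > 0` at the grid nodes
and discrete Lévy weights with `Σ_{q≠0} ν̃_q⁻ λ_q ≤ B (L/m)²` (`λ_q = Σ_a (1 − cos(2πq_a/m))`; this is
`NegLevySecondMoment`, strictly weaker than `GridInfDivCoherence` and than its `Tol` form), then together
with `LevyNegativeMoment` and `GridAverageCondensate` the conclusion of `LevyMassCondensation` (constant-mode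
condensation of near-minimisers on the torus at every small density) follows — by the single-state glue
`gridAverage_exp_lower_bound` (with `s = 1`), the uniform energy ceiling `periodicGroundStateEnergy_le_uniform`,
the pigeonhole `exists_particle_kinetic_le` and `GridAverageCondensate`, exactly as in the landed glue.
[BergChristensenRessel1984 Ch. 3–4; LiebSeiringerSolovejYngvason2005 Thm 2.2] -/
theorem periodicBEC_of_negLevySecondMoment :
    (∀ v : ℝ → ℝ≥0∞, IsRepulsiveFiniteRange v → ∃ η : ℝ, 0 < η ∧ ∃ B : ℝ, ∃ ρ₀ : ℝ, 0 < ρ₀ ∧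
      ∀ ρ : ℝ, 0 < ρ → ρ < ρ₀ → ∀ᶠ N : ℕ in atTop, ∃ δ : ℝ≥0∞, 0 < δ ∧
        ∀ Ψ : PeriodicTrialState N (sideLength ρ N),
          periodicEnergy v Ψ ≤ periodicGroundStateEnergy v N (sideLength ρ N) + δ →
          ∀ i : Fin N,
            let L : ℝ := sideLength ρ N
            let m : ℕ := ⌊L / η⌋₊
            let G : EuclideanSpace ℝ (Fin 3) → ℝ := fun r =>
              (∫ X in cellN N L, conj (Ψ.ψ (Function.update X i (X i + r))) * Ψ.ψ X).re
            (∀ j : Fin 3 → Fin m, 0 < G (latticeVec (L / m) fun k => ((j k : ℕ) : ℤ))) ∧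
            (∑ q : Fin 3 → Fin m with (∃ k, (q k : ℕ) ≠ 0),
              max (-((∑ j : Fin 3 → Fin m, Real.log (G (latticeVec (L / m) fun k => ((j k : ℕ) : ℤ))) *
                Real.cos (2 * Real.pi * (∑ k, ((q k : ℕ) : ℝ) * ((j k : ℕ) : ℝ)) / m)) / (m : ℝ) ^ 3)) 0 *
              (∑ a, (1 - Real.cos (2 * Real.pi * ((q a : ℕ) : ℝ) / m)))) ≤ B * (L / m) ^ 2) →
    Summit.AtomisticToContinuum.BoseEinsteinCondensation.Theses.BECInfDivCoherence.LevyNegativeMoment →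
    Summit.AtomisticToContinuum.BoseEinsteinCondensation.Theses.BECInfDivCoherence.GridAverageCondensate →
    ∀ v : ℝ → ℝ≥0∞, IsRepulsiveFiniteRange v → ∃ ρ₀ : ℝ, 0 < ρ₀ ∧ ∀ ρ : ℝ, 0 < ρ → ρ < ρ₀ →
      ∃ c : ℝ, 0 < c ∧ ∀ᶠ N : ℕ in atTop, ∃ δ : ℝ≥0∞, 0 < δ ∧
        ∀ Ψ : PeriodicTrialState N (sideLength ρ N),
          periodicEnergy v Ψ ≤ periodicGroundStateEnergy v N (sideLength ρ N) + δ →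
          ENNReal.ofReal (c * N) ≤ condensateOccupation N (sideLength ρ N) Ψ.ψ := by
  intro h1 h2 h4 v hv
  obtain ⟨R₀, hR₀⟩ := hv.2
  set R : ℝ := max R₀ 1 with hRdef
  have hR : 0 < R := lt_max_of_lt_right one_pos
  have hvR : ∀ r, R < r → v r = 0 := fun r hr => hR₀ r ((le_max_left _ _).trans_lt hr)
  obtain ⟨η, hη, B, ρ₁, hρ₁, H1⟩ := h1 v hv
  obtain ⟨C, ρ₂, hρ₂, H2⟩ := h2 v hv η hη
  obtain ⟨ρ₃, hρ₃, H3⟩ := periodicGroundStateEnergy_le_uniform hR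
  -- constants (`s = 1`, `T ≤ 1` in the single-state glue)
  set Λ : ℝ := Real.pi ^ 2 * (1 + max B 0) / 6 + 2 * max C 0 / 3 with hΛ
  set c : ℝ := Real.exp (-Λ) / 2 with hc
  have hcpos : 0 < c := by positivity
  set κ : ℝ := min (1 / 2) (min (1 / (8 * η ^ 2)) (c / (2 * η ^ 2))) with hκ
  have hκpos : 0 < κ := by positivity
  have hκ1 : κ ≤ 1 / 2 := min_le_left _ _
  have hκ2 : κ ≤ 1 / (8 * η ^ 2) := (min_le_right _ _).trans (min_le_left _ _)
  have hκ3 : κ ≤ c / (2 * η ^ 2) := (min_le_right _ _).trans (min_le_right _ _)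
  set ρ₄ : ℝ := κ / (16 * Real.pi * R) with hρ₄
  have hρ₄pos : 0 < ρ₄ := by positivity
  refine ⟨min (min ρ₁ ρ₂) (min ρ₃ ρ₄), by positivity, fun ρ hρ hρlt => ?_⟩
  have hρ1 : ρ < ρ₁ := hρlt.trans_le ((min_le_left _ _).trans (min_le_left _ _))
  have hρ2 : ρ < ρ₂ := hρlt.trans_le ((min_le_left _ _).trans (min_le_right _ _))
  have hρ3 : ρ < ρ₃ := hρlt.trans_le ((min_le_right _ _).trans (min_le_left _ _))
  have hρ4 : ρ < ρ₄ := hρlt.trans_le ((min_le_right _ _).trans (min_le_right _ _))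
  set e : ℝ := 16 * Real.pi * R * ρ with he
  have hepos : 0 ≤ e := by positivity
  have heκ : e < κ := by
    have : 16 * Real.pi * R * ρ < 16 * Real.pi * R * (κ / (16 * Real.pi * R)) :=
      mul_lt_mul_of_pos_left hρ4 (by positivity)
    rwa [mul_div_cancel₀ _ (by positivity : (16 * Real.pi * R : ℝ) ≠ 0)] at this
  refine ⟨c, hcpos, ?_⟩
  have hNκ : ∀ᶠ N : ℕ in atTop, (1 : ℝ) / N ≤ κ :=
    tendsto_one_div_atTop_nhds_zero_nat.eventually (eventually_le_nhds hκpos)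
  filter_upwards [H1 ρ hρ hρ1, H2 ρ hρ hρ2, H3 ρ hρ hρ3, eventually_ge_atTop 2, hNκ,
    (tendsto_sideLength_atTop hρ).eventually_ge_atTop (3 * η)] with N hN1 hN2 hN3 hN2le hNκ' hL3η
  have hN0 : 0 < N := by omega
  have hNpos : (0 : ℝ) < N := by exact_mod_cast hN0
  have hE0 : periodicGroundStateEnergy v N (sideLength ρ N) ≤ ENNReal.ofReal (e * N) := by
    have := hN3 v hvR; rwa [he]
  have hLpos : 0 < sideLength ρ N := by
    unfold sideLength; exact Real.rpow_pos_of_pos (div_pos hNpos hρ) _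
  have heN : e + 1 / N ≤ 2 * κ := by linarith
  clear hN3 H1 H2 H3
  generalize sideLength ρ N = L at hN1 hN2 hE0 hLpos hL3η ⊢
  -- the grid size `m = ⌊L/η⌋ ≥ 3` and spacing `h = L/m ≤ 2η`
  have hm3 : 3 ≤ ⌊L / η⌋₊ := Nat.le_floor (by rw [Nat.cast_ofNat, le_div_iff₀ hη]; linarith)
  have hmlt : L / η < ⌊L / η⌋₊ + 1 := Nat.lt_floor_add_one _
  dsimp only at hN1 hN2
  set m : ℕ := ⌊L / η⌋₊ with hmdef
  haveI : NeZero m := ⟨by omega⟩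
  have hm2 : 2 ≤ m := by omega
  have hm0 : 0 < m := by omega
  have hmpos : (0 : ℝ) < m := by exact_mod_cast hm0
  have hh2 : L / m ≤ 2 * η := by
    rw [div_le_iff₀ hmpos]
    rw [div_lt_iff₀ hη] at hmlt
    nlinarith
  have hhpos : 0 < L / m := div_pos hLpos hmpos
  have hh2sq : (L / m) ^ 2 ≤ 4 * η ^ 2 := by nlinarith
  obtain ⟨δ₁, hδ₁, H1'⟩ := hN1
  obtain ⟨δ₂, hδ₂, H2'⟩ := hN2
  refine ⟨min (min δ₁ δ₂) 1, lt_min (lt_min hδ₁ hδ₂) one_pos, fun Ψ hΨ => ?_⟩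
  have hΨ1 : periodicEnergy v Ψ ≤ periodicGroundStateEnergy v N L + δ₁ :=
    hΨ.trans (add_le_add le_rfl ((min_le_left _ _).trans (min_le_left _ _)))
  have hΨ2 : periodicEnergy v Ψ ≤ periodicGroundStateEnergy v N L + δ₂ :=
    hΨ.trans (add_le_add le_rfl ((min_le_left _ _).trans (min_le_right _ _)))
  -- kinetic energy `≤ eN + 1`, and a particle with kinetic energy `≤ e + 1/N`
  set T : ℝ := e * N + 1 with hT
  have hTpos : 0 ≤ T := by positivity
  have hkin : (∫⁻ X in cellN N L, kineticDensity Ψ.ψ X) ≤ ENNReal.ofReal T :=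
    calc (∫⁻ X in cellN N L, kineticDensity Ψ.ψ X) ≤ periodicEnergy v Ψ :=
          lintegral_kineticDensity_le_periodicEnergy v Ψ
      _ ≤ periodicGroundStateEnergy v N L + min (min δ₁ δ₂) 1 := hΨ
      _ ≤ ENNReal.ofReal (e * N) + 1 := add_le_add hE0 (min_le_right _ _)
      _ = ENNReal.ofReal T := by
          rw [hT, ENNReal.ofReal_add (by positivity) zero_le_one, ENNReal.ofReal_one]
  obtain ⟨i, hi⟩ := exists_particle_kinetic_le Ψ hN0 hkin
  have hTN : ENNReal.ofReal T / N = ENNReal.ofReal (e + 1 / N) := by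
    rw [hT, show e + 1 / N = (e * N + 1) / N by field_simp, ENNReal.ofReal_div_of_pos hNpos,
      ENNReal.ofReal_natCast]
  rw [hTN] at hi
  have heN0 : 0 ≤ e + 1 / N := by positivity
  have heN1 : e + 1 / N ≤ 1 := by linarith
  have hsmall : (L / m) ^ 2 * (e + 1 / N) ≤ 1 := by
    have h8 : 8 * η ^ 2 * κ ≤ 1 := by
      rw [le_div_iff₀ (by positivity)] at hκ2; linarith only [hκ2]
    calc (L / m) ^ 2 * (e + 1 / N) ≤ (4 * η ^ 2) * (2 * κ) := by gcongr
      _ = 8 * η ^ 2 * κ := by ring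
      _ ≤ 1 := h8
  -- the two crux inputs for this particle
  obtain ⟨hGpos, hBi⟩ := H1' Ψ hΨ1 i
  have hCi := H2' Ψ hΨ2 i
  have hBi' := hBi.trans (mul_le_mul_of_nonneg_right (le_max_left B 0) (sq_nonneg _))
  have hCi' := hCi.trans (le_max_left C 0)
  -- the single-state glue with `s = 1`
  have hcore := gridAverage_exp_lower_bound N L hLpos m hm2 Ψ i
    (fun r => (∫ X in cellN N L, conj (Ψ.ψ (Function.update X i (X i + r))) * Ψ.ψ X).re)
    (fun r => rfl) (e + 1 / N) (max B 0 * (L / m) ^ 2) (max C 0) 1 one_pos heN0 hsmall hi hGpos hBi' hCi'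
  have hexp : 2 * c ≤ (∑ j : Fin 3 → Fin m, (∫ X in cellN N L, conj (Ψ.ψ (Function.update X i
      (X i + latticeVec (L / m) fun k => ((j k : ℕ) : ℤ)))) * Ψ.ψ X).re) / (m : ℝ) ^ 3 := by
    refine le_trans ?_ hcore
    have h2c : 2 * c = Real.exp (-Λ) := by rw [hc]; ring
    rw [h2c, Real.exp_le_exp, neg_le_neg_iff]
    have hB0 : 0 ≤ max B 0 := le_max_right _ _
    have hC0 : 0 ≤ max C 0 := le_max_right _ _
    have hfrac : max B 0 * (L / m) ^ 2 / (L / m) ^ 2 = max B 0 := by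
      field_simp
    rw [hfrac, hΛ]
    have h1' : Real.pi ^ 2 * (e + 1 / N + max B 0) / (6 * (1 : ℝ) ^ 2) ≤
        Real.pi ^ 2 * (1 + max B 0) / 6 := by
      rw [one_pow, mul_one]
      gcongr
    linarith
  -- `GridAverageCondensate` and the error term `T h²/(4π²) ≤ c N`
  have h4i : ENNReal.ofReal (N * (∑ j : Fin 3 → Fin m, (∫ X in cellN N L, conj (Ψ.ψ (Function.update X i
      (X i + latticeVec (L / m) fun k => ((j k : ℕ) : ℤ)))) * Ψ.ψ X).re) /
      (m : ℝ) ^ 3 - T * (L / m) ^ 2 / (4 * Real.pi ^ 2)) ≤ condensateOccupation N L Ψ.ψ :=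
    h4 N m L T hLpos hm0 hTpos Ψ hkin i
  refine le_trans (ENNReal.ofReal_le_ofReal ?_) h4i
  have hπ : 1 ≤ Real.pi ^ 2 := one_le_pow₀ (by linarith only [Real.pi_gt_three])
  have hκc : 2 * κ * η ^ 2 ≤ c := by
    rw [le_div_iff₀ (by positivity)] at hκ3; linarith only [hκ3]
  have hTerr : T * (L / m) ^ 2 / (4 * Real.pi ^ 2) ≤ c * N := by
    have hTh : 0 ≤ T * (L / m) ^ 2 := by positivity
    calc T * (L / m) ^ 2 / (4 * Real.pi ^ 2) ≤ T * (L / m) ^ 2 / 4 :=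
          div_le_div_of_nonneg_left hTh (by norm_num) (by linarith only [hπ])
      _ ≤ T * η ^ 2 := by
          have := mul_le_mul_of_nonneg_left hh2sq hTpos; linarith only [this]
      _ = N * ((e + 1 / N) * η ^ 2) := by rw [hT]; field_simp
      _ ≤ N * (2 * κ * η ^ 2) := by gcongr
      _ ≤ N * c := by gcongr
      _ = c * N := mul_comm _ _
  have hmain := mul_le_mul_of_nonneg_left hexp hNpos.le
  rw [mul_div_assoc]
  linarith only [hmain, hTerr]

/-- **The filed crux implies the weakened one** (`GridInfDivCoherence → NegLevySecondMoment` with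
`B = 1`): given `N` (hence `m = ⌊L/η⌋₊` and `h = L/m ≥ η`), feed the crux with
`ε := (h² + η²)/(12(m³ + 1))`; then `ν⁻ ≤ ε` off the origin and `Σ_{q≠0} ν⁻_q λ_q ≤ 6εm³ ≤ h²`
(`λ_q ≤ 6`), while `G > 0` everywhere gives `G > 0` at the nodes. So the restated crux is at most as
strong as the filed one (cf. the refuter's `Tol` form, which lies in between). [folklore] -/
theorem negLevySecondMoment_of_gridInfDiv
    (h : Summit.AtomisticToContinuum.BoseEinsteinCondensation.Theses.BECInfDivCoherence.GridInfDivCoherence) :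
    ∀ v : ℝ → ℝ≥0∞, IsRepulsiveFiniteRange v → ∃ η : ℝ, 0 < η ∧ ∃ B : ℝ, ∃ ρ₀ : ℝ, 0 < ρ₀ ∧
      ∀ ρ : ℝ, 0 < ρ → ρ < ρ₀ → ∀ᶠ N : ℕ in atTop, ∃ δ : ℝ≥0∞, 0 < δ ∧
        ∀ Ψ : PeriodicTrialState N (sideLength ρ N),
          periodicEnergy v Ψ ≤ periodicGroundStateEnergy v N (sideLength ρ N) + δ →
          ∀ i : Fin N,
            let L : ℝ := sideLength ρ N
            let m : ℕ := ⌊L / η⌋₊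
            let G : EuclideanSpace ℝ (Fin 3) → ℝ := fun r =>
              (∫ X in cellN N L, conj (Ψ.ψ (Function.update X i (X i + r))) * Ψ.ψ X).re
            (∀ j : Fin 3 → Fin m, 0 < G (latticeVec (L / m) fun k => ((j k : ℕ) : ℤ))) ∧
            (∑ q : Fin 3 → Fin m with (∃ k, (q k : ℕ) ≠ 0),
              max (-((∑ j : Fin 3 → Fin m, Real.log (G (latticeVec (L / m) fun k => ((j k : ℕ) : ℤ))) *
                Real.cos (2 * Real.pi * (∑ k, ((q k : ℕ) : ℝ) * ((j k : ℕ) : ℝ)) / m)) / (m : ℝ) ^ 3)) 0 *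
              (∑ a, (1 - Real.cos (2 * Real.pi * ((q a : ℕ) : ℝ) / m)))) ≤ B * (L / m) ^ 2 := by
  intro v hv
  obtain ⟨η, hη, ρ₀, hρ₀, H⟩ := h v hv
  refine ⟨η, hη, 1, ρ₀, hρ₀, fun ρ hρ hρlt => ?_⟩
  filter_upwards [H ρ hρ hρlt] with N hN
  -- the grid is known: choose the tolerance
  set M : ℕ := ⌊sideLength ρ N / η⌋₊ with hMdef
  set hh : ℝ := sideLength ρ N / M with hhdef
  set ε : ℝ := (hh ^ 2 + η ^ 2) / (12 * ((M : ℝ) ^ 3 + 1)) with hεdef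
  have hεpos : 0 < ε := by positivity
  obtain ⟨δ, hδ, HΨ⟩ := hN ε hεpos
  refine ⟨δ, hδ, fun Ψ hΨ i => ?_⟩
  have hi := HΨ Ψ hΨ i
  dsimp only at hi ⊢
  obtain ⟨hpos, hlevy⟩ := hi
  refine ⟨fun j => hpos _, ?_⟩
  -- `ν⁻ ≤ ε` off the origin, `λ ≤ 6`, `card = M³`
  have hkey : 6 * ε * (M : ℝ) ^ 3 ≤ 1 * hh ^ 2 := by
    rcases Nat.eq_zero_or_pos M with h0 | hMpos
    · simp [h0, sq_nonneg]
    · have hηh : η ≤ hh := by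
        rw [hhdef, le_div_iff₀ (by exact_mod_cast hMpos)]
        have hfl : (M : ℝ) ≤ sideLength ρ N / η := Nat.floor_le (by
          have : 0 < sideLength ρ N := by
            unfold sideLength
            exact Real.rpow_pos_of_pos (div_pos (Nat.cast_pos.2 (Fin.pos i)) hρ) _
          positivity)
        rw [le_div_iff₀ hη] at hfl
        linarith
      have hη2 : η ^ 2 ≤ hh ^ 2 := pow_le_pow_left₀ hη.le hηh 2
      rw [hεdef]
      have hM3 : (0 : ℝ) ≤ (M : ℝ) ^ 3 := by positivity
      rw [show 6 * ((hh ^ 2 + η ^ 2) / (12 * ((M : ℝ) ^ 3 + 1))) * (M : ℝ) ^ 3 =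
        (hh ^ 2 + η ^ 2) / 2 * ((M : ℝ) ^ 3 / ((M : ℝ) ^ 3 + 1)) by field_simp; ring]
      have hfrac : (M : ℝ) ^ 3 / ((M : ℝ) ^ 3 + 1) ≤ 1 := by
        rw [div_le_one (by positivity)]; linarith
      calc (hh ^ 2 + η ^ 2) / 2 * ((M : ℝ) ^ 3 / ((M : ℝ) ^ 3 + 1))
          ≤ (hh ^ 2 + η ^ 2) / 2 * 1 := mul_le_mul_of_nonneg_left hfrac (by positivity)
        _ ≤ 1 * hh ^ 2 := by linarith
  refine le_trans ?_ hkey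
  calc (∑ q ∈ Finset.univ.filter (fun q : Fin 3 → Fin M => ∃ k, (q k : ℕ) ≠ 0),
        max (-((∑ j : Fin 3 → Fin M, Real.log ((∫ X in cellN N (sideLength ρ N),
          conj (Ψ.ψ (Function.update X i (X i + latticeVec (sideLength ρ N / M)
            fun k => ((j k : ℕ) : ℤ)))) * Ψ.ψ X).re) *
          Real.cos (2 * Real.pi * (∑ k, ((q k : ℕ) : ℝ) * ((j k : ℕ) : ℝ)) / M)) / (M : ℝ) ^ 3)) 0 *
        (∑ a, (1 - Real.cos (2 * Real.pi * ((q a : ℕ) : ℝ) / M))))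
      ≤ ∑ q ∈ Finset.univ.filter (fun q : Fin 3 → Fin M => ∃ k, (q k : ℕ) ≠ 0), ε * 6 := by
        refine Finset.sum_le_sum fun q hq => ?_
        rw [Finset.mem_filter] at hq
        have hν := hlevy q hq.2
        refine mul_le_mul (max_le (by linarith) hεpos.le) (fsumWeight_le_six q) (fsumWeight_nonneg q) hεpos.le
    _ ≤ ∑ _q : Fin 3 → Fin M, ε * 6 :=
        Finset.sum_le_sum_of_subset_of_nonneg (Finset.filter_subset _ _) fun _ _ _ => by positivity
    _ = 6 * ε * (M : ℝ) ^ 3 := by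
        rw [Finset.sum_const, Finset.card_univ, Fintype.card_fun, Fintype.card_fin, Fintype.card_fin,
          nsmul_eq_mul, Nat.cast_pow]
        ring

end Summit.AtomisticToContinuum.BoseEinsteinCondensation.Theorems

end
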